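import Literature.Probability.RandomPlanarGeometry.HexSAWStripWidthThreeHatRecursion
import HarnessLib

/-!
# The width-three strip: the CONTACT hat sums of `S₃` and their squares obey the same order-four recursion, driven by the lower moments —
# `Ĉ(k+4) = G₃Ĉ(k+3) + q(1+E′)Ĉ(k+1) − qG₃Ĉ(k) + Ġ₃D̂(k+3) + q(1+E′)D̂(k+1) − q(G₃+Ġ₃)D̂(k)` and its `y∂_y` (module «WIDTH-THREE HAT CONTACT RECURSION»)

Topic `Literature/Probability/RandomPlanarGeometry` (continues «WIDTH-THREE HAT RECURSION» `HexSAWStripWidthThreeHatRecursion.lean` — `W3.hatD_three_rec`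
(`D̂(k+4) = G₃D̂(k+3) + q(1+E′)D̂(k+1) − qG₃D̂(k)`, `k ≥ 1`, `0 ≤ y`), `W3.gThree`, `W3.ePrimeThree`; uses «CONTACT-DENSITY» / «CONTACT-LLN»
(`HV.hasDerivAt_LUs`, `HV.mul_derivSum_eq_contactSum`, `HV.hasDerivAt_contactSum`, `HV.mul_derivContactSum_eq`: the bridge slices are polynomials in
`y`, `y∂_y` of a slice is its contact-weighted version); the width-two twins are «WIDTH-TWO CONTACT RECURSION» `W2.hatCD_two_succ : Ĉ_D(k+1) = GĈ_D(k) + K₁D̂(k)`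
and `W2.hatC2D_two_succ`).  Lane «pcv-sawmu» (CriticalPhenomena venture), a-p2 g28 — step 3 of the width-three contact-variance programme.  The bridge
recursion of car 1 is an identity between polynomials in the surface fugacity `y` on `[0, ∞)`; applying `y∂_y` entrywise (uniqueness of the derivative on
the open half-line) turns bridge sums into contact sums (`y∂_yD̂ = Ĉ`, `y∂_yĈ = Ĉ²`), `G₃` into its contact-marked part `Ġ₃ = y∂_yG₃` (entries `(4,5) = xy`,
`(5,5) = x²y`; `y∂_yĠ₃ = Ġ₃`), `q = x⁶y` into itself and leaves `E′` fixed — so the first and second contact moments obey the SAME homogeneous recursion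
with explicit sources.  No generating functions, no case analysis on bridges.  Sources of the SETTING: W. Feller I (1968) XIII.3 (renewal equation),
XIII.6 (moments of the number of renewals); H. Duminil-Copin, A. Hammond, CMP 324 (2013) §2.2; R. P. Stanley EC1 (2012) §4.1.  Nothing below is printed.

## What is proved (namespace `Literature.Probability.RandomPlanarGeometry.SAW.HV.W3`; `x = x_c`, `q = x⁶y`, `G₃ = gThree y`, `Ġ₃ = gDotThree y`, `E′ = ePrimeThree`)

* §1 `hatCD y k` (`Ĉ_D(k)`, contact-weighted hat bridge sums of `S₃`), `gDerivThree` (`∂_yG₃`), `gDotThree y = y • gDerivThree`, `hasDerivAt_gThree_apply`.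
* §2 ★★★ **`hatCD_three_rec (hy : 0 < y) (hk : 1 ≤ k) : hatCD y (k+4) = G₃ * hatCD y (k+3) + q • ((1+E′) * hatCD y (k+1)) − q • (G₃ * hatCD y k)
  + (Ġ₃ * hatD 3 y (k+3) + q • ((1+E′) * hatD 3 y (k+1)) − q • ((G₃ + Ġ₃) * hatD 3 y k))`**.
* §3 `hatC2D y k` (`Ĉ²_D(k)`), `hasDerivAt_gDotThree_apply`; ★★★ **`hatC2D_three_rec (hy : 0 < y) (hk : 1 ≤ k) : hatC2D y (k+4) = G₃ * hatC2D y (k+3)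
  + q • ((1+E′) * hatC2D y (k+1)) − q • (G₃ * hatC2D y k) + (2 • (Ġ₃ * hatCD y (k+3)) + (2q) • ((1+E′) * hatCD y (k+1)) − (2q) • ((G₃+Ġ₃) * hatCD y k))
  + (Ġ₃ * hatD 3 y (k+3) + q • ((1+E′) * hatD 3 y (k+1)) − q • ((G₃ + 3•Ġ₃) * hatD 3 y k))`** — both checked against exact renewal numerics
  (`HOME/pub-sawmu-a-p2/g28/crec/check_c2.py`, residuals ≤ 3·10⁻¹⁶).

Label: LANE THEOREM (own result of lane «pcv-sawmu», a-p2 g28, 2026-08-28; not in print).  NOT claimed: the asymptotics `Ĉ_D(k) = A₁k + A₀ + o(1)`,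
`Ĉ²_D(k) = qk² + ℓk + m + o(1)` (needs the spectral gap of the companion matrix of «WIDTH-THREE HAT COMPANION», numerics kit j300802) and the variance rate
`σ₃²` (conjecture + cells: `HOME/FINDING-WIDTH-THREE-CONTACT-VARIANCE-CONJECTURE.md`, PREREG claim of 2026-08-28 06:25Z); any `T ≥ 4`.
-/

noncomputable section

open Finset Filter Topology Matrix Literature.Probability.LatticeModels Literature.Probability.Percolation

namespace Literature.Probability.RandomPlanarGeometry.SAW

namespace HV

namespace W3

/-! ## §1 The contact hat sums of `S₃` and the `y`-derivative of `G₃` -/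

/-- The contact-weighted hat bridge sum of `S₃`: `Ĉ_D(k)_{ab} = Σ_{standard bridges a→b with 2k+χ_a−χ_b steps} #top · x^{#steps} y^{#top}` (the object of
the tree's `hat_contact_ren` at `T = 3`; the width-two twin is `W2.hatCD`). [cite: DuminilCopinHammond2013, §2.2; Feller1968, XIII.3; lane «pcv-sawmu» a-p2 g28] -/
def hatCD (y : ℝ) (k : ℕ) : Matrix (Fin (2 * 3)) (Fin (2 * 3)) ℝ :=
  Matrix.of fun a b : Fin (2 * 3) => ∑ l ∈ LUset 3 (2 * k + 1) (hatLen k a b) (a : ℕ) (b : ℕ), (topCnt 3 l.tail : ℝ) * wD 3 y l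

/-- The `y`-derivative `∂_y G₃` of the one-step matrix: entries `(4,5) = x`, `(5,5) = x²`, all others `0` (only the surface slant carries `y`).
[cite: Feller1968, XIII.3; lane «pcv-sawmu» a-p2 g28] -/
def gDerivThree : Matrix (Fin (2 * 3)) (Fin (2 * 3)) ℝ :=
  Matrix.of ![![0, 0, 0, 0, 0, 0], ![0, 0, 0, 0, 0, 0], ![0, 0, 0, 0, 0, 0], ![0, 0, 0, 0, 0, 0], ![0, 0, 0, 0, 0, hexCriticalFugacity],
    ![0, 0, 0, 0, 0, hexCriticalFugacity ^ 2]]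

/-- `Ġ₃(y) = y·∂_y G₃(y)`: entries `(4,5) = xy`, `(5,5) = x²y` (the contact-marked part of `G₃`). [cite: Feller1968, XIII.3; lane «pcv-sawmu» a-p2 g28] -/
def gDotThree (y : ℝ) : Matrix (Fin (2 * 3)) (Fin (2 * 3)) ℝ := y • gDerivThree

/-- Every entry of `G₃(y)` is differentiable in `y` with derivative the corresponding entry of `gDerivThree` (plumbing).
[cite: Feller1968, XIII.3; lane plumbing] -/
theorem hasDerivAt_gThree_apply (a c : Fin (2 * 3)) (y : ℝ) : HasDerivAt (fun y => gThree y a c) (gDerivThree a c) y := by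
  fin_cases a <;> fin_cases c <;> simp [gThree, gDerivThree] <;>
    first
    | exact hasDerivAt_const _ _
    | simpa using (hasDerivAt_id y).const_mul hexCriticalFugacity
    | simpa using (hasDerivAt_id y).const_mul (hexCriticalFugacity ^ 2)

/-! ## §2 The contact recursion: `y∂_y` of «WIDTH-THREE HAT RECURSION» -/

/-- ★★★ **The contact hat sums of the width-three strip obey the order-four recursion of the bridge sums, with the bridge sums as a source**:
for every `y > 0` and `k ≥ 1`, with `q = x⁶y`, `G₃ = gThree y`, `Ġ₃ = gDotThree y = y∂_yG₃`, `E′ = ePrimeThree`,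
`Ĉ(k+4) = G₃·Ĉ(k+3) + q(1+E′)·Ĉ(k+1) − q·G₃·Ĉ(k) + Ġ₃·D̂(k+3) + q(1+E′)·D̂(k+1) − q·(G₃ + Ġ₃)·D̂(k)`.
Proof: `hatD_three_rec` is an identity between polynomials in `y` on `[0, ∞)`; apply `y∂_y` entrywise (`y∂_y D̂ = Ĉ`, `y∂_y G₃ = Ġ₃`, `y∂_y q = q`,
`∂_y E′ = 0`) and compare derivatives by uniqueness.  The width-two twin is «WIDTH-TWO CONTACT RECURSION»'s `Ĉ_D(k+1) = G·Ĉ_D(k) + K₁·D̂(k)`.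
[cite: Feller1968, XIII.3 (renewal equation), XIII.6 (moments of the number of renewals); DuminilCopinHammond2013, §2.2; lane «pcv-sawmu» a-p2 g28 — own result, not in print] -/
theorem hatCD_three_rec {y : ℝ} (hy : 0 < y) {k : ℕ} (hk : 1 ≤ k) :
    hatCD y (k + 4) = gThree y * hatCD y (k + 3) + (hexCriticalFugacity ^ 6 * y) • ((1 + ePrimeThree) * hatCD y (k + 1))
      - (hexCriticalFugacity ^ 6 * y) • (gThree y * hatCD y k)
      + (gDotThree y * hatD 3 y (k + 3) + (hexCriticalFugacity ^ 6 * y) • ((1 + ePrimeThree) * hatD 3 y (k + 1))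
        - (hexCriticalFugacity ^ 6 * y) • ((gThree y + gDotThree y) * hatD 3 y k)) := by
  ext a b
  -- derivative sums of the hat bridge slices
  set dU : ℕ → Fin (2 * 3) → Fin (2 * 3) → ℝ → ℝ := fun k c d y =>
    ∑ l ∈ LUset 3 (2 * k + 1) (hatLen k c d) (c : ℕ) (d : ℕ), hexCriticalFugacity ^ (l.length - 1) * ((topCnt 3 l.tail : ℝ) * y ^ (topCnt 3 l.tail - 1))
    with hdU
  have hD : ∀ j (c d : Fin (2 * 3)) (y : ℝ), HasDerivAt (fun y => hatD 3 y j c d) (dU j c d y) y := fun j c d y =>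
    hasDerivAt_LUs (2 * j + 1) (hatLen j c d) _ _ y
  have hU : ∀ j (c d : Fin (2 * 3)), y * dU j c d y = hatCD y j c d := fun j c d => by
    rw [hdU]; simp only [hatCD, Matrix.of_apply]; exact mul_derivSum_eq_contactSum _ y
  -- the right-hand side of the bridge recursion, entry (a,b), as a function of y, and its derivative
  set R : ℝ → ℝ := fun y => ∑ c, gThree y a c * hatD 3 y (k + 3) c b
      + hexCriticalFugacity ^ 6 * y * ∑ c, (1 + ePrimeThree) a c * hatD 3 y (k + 1) c b
      - hexCriticalFugacity ^ 6 * y * ∑ c, gThree y a c * hatD 3 y k c b with hR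
  set R' : ℝ := ∑ c, (gDerivThree a c * hatD 3 y (k + 3) c b + gThree y a c * dU (k + 3) c b y)
      + (hexCriticalFugacity ^ 6 * ∑ c, (1 + ePrimeThree) a c * hatD 3 y (k + 1) c b
        + hexCriticalFugacity ^ 6 * y * ∑ c, (1 + ePrimeThree) a c * dU (k + 1) c b y)
      - (hexCriticalFugacity ^ 6 * ∑ c, gThree y a c * hatD 3 y k c b
        + hexCriticalFugacity ^ 6 * y * ∑ c, (gDerivThree a c * hatD 3 y k c b + gThree y a c * dU k c b y)) with hR'
  have hq : HasDerivAt (fun y : ℝ => hexCriticalFugacity ^ 6 * y) (hexCriticalFugacity ^ 6) y := by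
    simpa using (hasDerivAt_id y).const_mul (hexCriticalFugacity ^ 6)
  have hRd : HasDerivAt R R' y := by
    have h1 : HasDerivAt (fun y => ∑ c, gThree y a c * hatD 3 y (k + 3) c b)
        (∑ c, (gDerivThree a c * hatD 3 y (k + 3) c b + gThree y a c * dU (k + 3) c b y)) y :=
      HasDerivAt.fun_sum fun c _ => (hasDerivAt_gThree_apply a c y).mul (hD (k + 3) c b y)
    have h2 : HasDerivAt (fun y => ∑ c, (1 + ePrimeThree) a c * hatD 3 y (k + 1) c b) (∑ c, (1 + ePrimeThree) a c * dU (k + 1) c b y) y :=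
      HasDerivAt.fun_sum fun c _ => (hD (k + 1) c b y).const_mul _
    have h3 : HasDerivAt (fun y => ∑ c, gThree y a c * hatD 3 y k c b) (∑ c, (gDerivThree a c * hatD 3 y k c b + gThree y a c * dU k c b y)) y :=
      HasDerivAt.fun_sum fun c _ => (hasDerivAt_gThree_apply a c y).mul (hD k c b y)
    have h := (h1.add (hq.mul h2)).sub (hq.mul h3)
    rw [hR, hR']
    exact h
  -- the bridge recursion as an eventual equality of functions of y near y > 0
  have hFG : R =ᶠ[𝓝 y] fun y => hatD 3 y (k + 4) a b := by
    filter_upwards [Ioi_mem_nhds hy] with y' hy'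
    have h := congr_fun (congr_fun (hatD_three_rec (le_of_lt hy') hk) a) b
    rw [h, hR]
    simp only [Matrix.add_apply, Matrix.sub_apply, Matrix.smul_apply, Matrix.mul_apply, smul_eq_mul, Finset.mul_sum]
  have huniq : dU (k + 4) a b y = R' := (hD (k + 4) a b y).unique (hRd.congr_of_eventuallyEq hFG.symm)
  -- multiply by y and read off
  have hL : hatCD y (k + 4) a b = y * R' := by rw [← huniq, hU]
  rw [hL, hR']
  simp only [Matrix.add_apply, Matrix.sub_apply, Matrix.smul_apply, Matrix.mul_apply, smul_eq_mul, gDotThree, Matrix.add_apply, ← hU]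
  simp only [Finset.mul_sum, Finset.sum_add_distrib, mul_add, add_mul]
  ring_nf
  simp only [Finset.mul_sum]
  ring_nf

/-! ## §3 The squared-contact hat sums: `y∂_y` once more -/

/-- The squared-contact hat bridge sum of `S₃`: `Ĉ²_D(k)_{ab} = Σ_{standard bridges a→b with 2k+χ_a−χ_b steps} #top² · x^{#steps} y^{#top}` (the second
factor of the variance; the width-two twin is `W2.hatC2D`). [cite: Feller1968, XIII.6 (moments of the number of renewals); DuminilCopinHammond2013, §2.2; lane «pcv-sawmu» a-p2 g28] -/
def hatC2D (y : ℝ) (k : ℕ) : Matrix (Fin (2 * 3)) (Fin (2 * 3)) ℝ :=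
  Matrix.of fun a b : Fin (2 * 3) => ∑ l ∈ LUset 3 (2 * k + 1) (hatLen k a b) (a : ℕ) (b : ℕ), (topCnt 3 l.tail : ℝ) ^ 2 * wD 3 y l

/-- Every entry of `Ġ₃(y) = y·∂_yG₃` is differentiable in `y` with derivative the entry of `gDerivThree` (so `y∂_y Ġ₃ = Ġ₃`; plumbing).
[cite: Feller1968, XIII.3; lane plumbing] -/
theorem hasDerivAt_gDotThree_apply (a c : Fin (2 * 3)) (y : ℝ) : HasDerivAt (fun y => gDotThree y a c) (gDerivThree a c) y := by
  simp only [gDotThree, Matrix.smul_apply, smul_eq_mul]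
  simpa using (hasDerivAt_id y).mul_const (gDerivThree a c)

/-- ★★★ **The second-moment contact recursion of the width-three strip**: for every `y > 0` and `k ≥ 1` (`q = x⁶y`, `G₃ = gThree y`,
`Ġ₃ = gDotThree y`, `E′ = ePrimeThree`),
`Ĉ²(k+4) = G₃Ĉ²(k+3) + q(1+E′)Ĉ²(k+1) − qG₃Ĉ²(k) + 2Ġ₃Ĉ(k+3) + 2q(1+E′)Ĉ(k+1) − 2q(G₃+Ġ₃)Ĉ(k) + Ġ₃D̂(k+3) + q(1+E′)D̂(k+1) − q(G₃+3Ġ₃)D̂(k)`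
— `y∂_y` applied to `hatCD_three_rec` (`y∂_yĈ = Ĉ²`, `y∂_yĠ₃ = Ġ₃`).  Together with `hatD_three_rec` and `hatCD_three_rec` this is the closed linear
system from which the variance of the surface contacts of long `S₃` bridges is computed (the width-two twin: `W2.hatC2D_two_succ`).
[cite: Feller1968, XIII.6 (second moment of renewal counts); DuminilCopinHammond2013, §2.2; lane «pcv-sawmu» a-p2 g28 — own result, not in print] -/
theorem hatC2D_three_rec {y : ℝ} (hy : 0 < y) {k : ℕ} (hk : 1 ≤ k) :
    hatC2D y (k + 4) = gThree y * hatC2D y (k + 3) + (hexCriticalFugacity ^ 6 * y) • ((1 + ePrimeThree) * hatC2D y (k + 1))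
      - (hexCriticalFugacity ^ 6 * y) • (gThree y * hatC2D y k)
      + ((2 : ℝ) • (gDotThree y * hatCD y (k + 3)) + (2 * (hexCriticalFugacity ^ 6 * y)) • ((1 + ePrimeThree) * hatCD y (k + 1))
        - (2 * (hexCriticalFugacity ^ 6 * y)) • ((gThree y + gDotThree y) * hatCD y k))
      + (gDotThree y * hatD 3 y (k + 3) + (hexCriticalFugacity ^ 6 * y) • ((1 + ePrimeThree) * hatD 3 y (k + 1))
        - (hexCriticalFugacity ^ 6 * y) • ((gThree y + (3 : ℝ) • gDotThree y) * hatD 3 y k)) := by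
  ext a b
  -- derivative sums of the bridge and contact slices
  set dU : ℕ → Fin (2 * 3) → Fin (2 * 3) → ℝ → ℝ := fun k c d y =>
    ∑ l ∈ LUset 3 (2 * k + 1) (hatLen k c d) (c : ℕ) (d : ℕ), hexCriticalFugacity ^ (l.length - 1) * ((topCnt 3 l.tail : ℝ) * y ^ (topCnt 3 l.tail - 1))
    with hdU
  set dC : ℕ → Fin (2 * 3) → Fin (2 * 3) → ℝ → ℝ := fun k c d y =>
    ∑ l ∈ LUset 3 (2 * k + 1) (hatLen k c d) (c : ℕ) (d : ℕ),
      (topCnt 3 l.tail : ℝ) * (hexCriticalFugacity ^ (l.length - 1) * ((topCnt 3 l.tail : ℝ) * y ^ (topCnt 3 l.tail - 1))) with hdC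
  have hD : ∀ j (c d : Fin (2 * 3)) (y : ℝ), HasDerivAt (fun y => hatD 3 y j c d) (dU j c d y) y := fun j c d y =>
    hasDerivAt_LUs (2 * j + 1) (hatLen j c d) _ _ y
  have hC : ∀ j (c d : Fin (2 * 3)) (y : ℝ), HasDerivAt (fun y => hatCD y j c d) (dC j c d y) y := fun j c d y => by
    simp only [hatCD, Matrix.of_apply]; exact hasDerivAt_contactSum _ y
  have hU : ∀ j (c d : Fin (2 * 3)), y * dU j c d y = hatCD y j c d := fun j c d => by
    rw [hdU]; simp only [hatCD, Matrix.of_apply]; exact mul_derivSum_eq_contactSum _ y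
  have hC2 : ∀ j (c d : Fin (2 * 3)), y * dC j c d y = hatC2D y j c d := fun j c d => by
    rw [hdC]; simp only [hatC2D, Matrix.of_apply]; exact mul_derivContactSum_eq _ y
  have hq : HasDerivAt (fun y : ℝ => hexCriticalFugacity ^ 6 * y) (hexCriticalFugacity ^ 6) y := by
    simpa using (hasDerivAt_id y).const_mul (hexCriticalFugacity ^ 6)
  have hGG : ∀ c, HasDerivAt (fun y => (gThree y + gDotThree y) a c) (gDerivThree a c + gDerivThree a c) y := fun c => by
    simp only [Matrix.add_apply]; exact (hasDerivAt_gThree_apply a c y).add (hasDerivAt_gDotThree_apply a c y)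
  -- the right-hand side of the contact recursion, entry (a,b), and its derivative
  set R : ℝ → ℝ := fun y =>
      ∑ c, gThree y a c * hatCD y (k + 3) c b + hexCriticalFugacity ^ 6 * y * ∑ c, (1 + ePrimeThree) a c * hatCD y (k + 1) c b
        - hexCriticalFugacity ^ 6 * y * ∑ c, gThree y a c * hatCD y k c b
      + (∑ c, gDotThree y a c * hatD 3 y (k + 3) c b + hexCriticalFugacity ^ 6 * y * ∑ c, (1 + ePrimeThree) a c * hatD 3 y (k + 1) c b
        - hexCriticalFugacity ^ 6 * y * ∑ c, (gThree y + gDotThree y) a c * hatD 3 y k c b) with hR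
  set R' : ℝ :=
      ∑ c, (gDerivThree a c * hatCD y (k + 3) c b + gThree y a c * dC (k + 3) c b y)
        + (hexCriticalFugacity ^ 6 * ∑ c, (1 + ePrimeThree) a c * hatCD y (k + 1) c b
          + hexCriticalFugacity ^ 6 * y * ∑ c, (1 + ePrimeThree) a c * dC (k + 1) c b y)
        - (hexCriticalFugacity ^ 6 * ∑ c, gThree y a c * hatCD y k c b
          + hexCriticalFugacity ^ 6 * y * ∑ c, (gDerivThree a c * hatCD y k c b + gThree y a c * dC k c b y))
      + (∑ c, (gDerivThree a c * hatD 3 y (k + 3) c b + gDotThree y a c * dU (k + 3) c b y)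
        + (hexCriticalFugacity ^ 6 * ∑ c, (1 + ePrimeThree) a c * hatD 3 y (k + 1) c b
          + hexCriticalFugacity ^ 6 * y * ∑ c, (1 + ePrimeThree) a c * dU (k + 1) c b y)
        - (hexCriticalFugacity ^ 6 * ∑ c, (gThree y + gDotThree y) a c * hatD 3 y k c b
          + hexCriticalFugacity ^ 6 * y * ∑ c, ((gDerivThree a c + gDerivThree a c) * hatD 3 y k c b + (gThree y + gDotThree y) a c * dU k c b y)))
    with hR'
  have hRd : HasDerivAt R R' y := by
    have h1 : HasDerivAt (fun y => ∑ c, gThree y a c * hatCD y (k + 3) c b)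
        (∑ c, (gDerivThree a c * hatCD y (k + 3) c b + gThree y a c * dC (k + 3) c b y)) y :=
      HasDerivAt.fun_sum fun c _ => (hasDerivAt_gThree_apply a c y).mul (hC (k + 3) c b y)
    have h2 : HasDerivAt (fun y => ∑ c, (1 + ePrimeThree) a c * hatCD y (k + 1) c b) (∑ c, (1 + ePrimeThree) a c * dC (k + 1) c b y) y :=
      HasDerivAt.fun_sum fun c _ => (hC (k + 1) c b y).const_mul _
    have h3 : HasDerivAt (fun y => ∑ c, gThree y a c * hatCD y k c b) (∑ c, (gDerivThree a c * hatCD y k c b + gThree y a c * dC k c b y)) y :=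
      HasDerivAt.fun_sum fun c _ => (hasDerivAt_gThree_apply a c y).mul (hC k c b y)
    have h4 : HasDerivAt (fun y => ∑ c, gDotThree y a c * hatD 3 y (k + 3) c b)
        (∑ c, (gDerivThree a c * hatD 3 y (k + 3) c b + gDotThree y a c * dU (k + 3) c b y)) y :=
      HasDerivAt.fun_sum fun c _ => (hasDerivAt_gDotThree_apply a c y).mul (hD (k + 3) c b y)
    have h5 : HasDerivAt (fun y => ∑ c, (1 + ePrimeThree) a c * hatD 3 y (k + 1) c b) (∑ c, (1 + ePrimeThree) a c * dU (k + 1) c b y) y :=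
      HasDerivAt.fun_sum fun c _ => (hD (k + 1) c b y).const_mul _
    have h6 : HasDerivAt (fun y => ∑ c, (gThree y + gDotThree y) a c * hatD 3 y k c b)
        (∑ c, ((gDerivThree a c + gDerivThree a c) * hatD 3 y k c b + (gThree y + gDotThree y) a c * dU k c b y)) y :=
      HasDerivAt.fun_sum fun c _ => (hGG c).mul (hD k c b y)
    have h := ((h1.add (hq.mul h2)).sub (hq.mul h3)).add ((h4.add (hq.mul h5)).sub (hq.mul h6))
    rw [hR, hR']
    exact h
  have hFG : R =ᶠ[𝓝 y] fun y => hatCD y (k + 4) a b := by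
    filter_upwards [Ioi_mem_nhds hy] with y' hy'
    have h := congr_fun (congr_fun (hatCD_three_rec hy' hk) a) b
    rw [h, hR]
    simp only [Matrix.add_apply, Matrix.sub_apply, Matrix.smul_apply, Matrix.mul_apply, smul_eq_mul, Finset.mul_sum]
  have huniq : dC (k + 4) a b y = R' := (hC (k + 4) a b y).unique (hRd.congr_of_eventuallyEq hFG.symm)
  have hL : hatC2D y (k + 4) a b = y * R' := by rw [← huniq, hC2]
  have hdot : ∀ c, gDotThree y a c = y * gDerivThree a c := fun c => by simp [gDotThree, Matrix.smul_apply]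
  rw [hL, hR']
  simp only [Matrix.add_apply, Matrix.sub_apply, Matrix.smul_apply, Matrix.mul_apply, smul_eq_mul, Matrix.add_apply, ← hU, ← hC2, hdot]
  simp only [Finset.mul_sum, Finset.sum_add_distrib, mul_add, add_mul]
  ring_nf
  simp only [Finset.mul_sum, Finset.sum_mul]
  ring_nf

end W3

end HV

end Literature.Probability.RandomPlanarGeometry.SAW
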